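import Summits.QuantumFields.YangMills.Theorems.SwapVirialDeficitSwapRingDeficit
import Summits.QuantumFields.YangMills.Theorems.TwistEaterVolumeTauberLaplace
import Summits.QuantumFields.YangMills.Theorems.SwapTwistDeficitTwistRatioFloorFixedL
import Summits.QuantumFields.YangMills.Theorems.ToronValleyVolumePeriodicRingCeilingLaplace
import Summits.QuantumFields.YangMills.Theorems.SwapVirialDeficitSwapRingLogFreeFloor
import HarnessLib

/-!
# The swap CEILING at fixed `L`, assembly layer (B-v), PARAMETRIC in per-sector sublevel-volume ceilings:
# `(∀ z, μ_L{F^S_z ≤ u} ≤ C_z·u^{9L⁴−1} on (0,u₀]) ⟹ Z^S ≤ C_L·e^{12βL⁴}·β^{−(9L⁴−1)} ⟹ ⟨S⟩ ≤ κ_L·β^{−1/2}/log β`, and then `⟨S⟩ ≍ β^{−1/2}/log β`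
# (free-hands support of item stmt-QuantumFields-24197 `SwapVirialDeficit.SwapGluedStiffness`; LEAD ym-line-sfw-p2 g93's 07:01Z ruling «(B-v) all-sector twistTrace
# ceiling + the two-sided ⟨S⟩ instantiation → default w3»; this file fixes the INTERFACE the sector owners deliver into: one power-law sublevel-volume ceiling
# per seam sector `z : Fin 3 → Bool` of the σ-glued ring — sector `0` from this seat's ✓/⧗`SwapRingCeiling*` + LEAD's ✓`SigmaTwistedCeiling`, the odd sectors
# from w2 g54's ✓`SigmaTwistedOddSectorEmpty` (volume `0`), the even twisted sectors from w2's (B-iii), all through fcl-p3 g43's general-`z` box (B-i))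

* §1 `integral_exp_neg_mul_le_of_pow_volume` — the log-free abstract Laplace ceiling: `μ{F ≤ s} ≤ C·s^N` on `(0, u₀]` (probability measure, `F ≥ 0`
  measurable) ⟹ `∫e^{−βF}dμ ≤ (C + u₀^{−N})·N!/β^N` for EVERY `β > 0` (layer cake ✓`Tauber.integral_exp_neg_mul_eq_integral_sublevel`; beyond `u₀` use
  `1 ≤ (s/u₀)^N`; no truncation tails);
* §2 ★★ `swap_twistTrace_ceiling_of_sectorVolumes` — `Z^S = (1/8)Σ_z e^{12βL⁴}∫e^{−βF^S_z}dμ_L` (✓`twistTrace_eq_sum_exp_mul_integral_deficit`) `≤ C_L·e^{12βL⁴}/β^{9L⁴−1}`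
  for all `β > 0`;
* §3 `twistRatio_ceiling_of_bounds` (real-number bookkeeping, the mirror of w2 g54's ✓`twistRatio_floor_of_bounds`), ★★ `twistRatio_ceiling_of_sectorVolumes`
  (with ✓`PeriodicRingFloor.log_physTrace_floor`: `⟨S⟩_β ≤ κ_L·β^{−1/2}/log β`), ★★★ `twistRatio_two_sided_of_sectorVolumes` (with ✓`twistRatio_floor_of_exists`,
  ✓`PeriodicRingCeiling.log_physTrace_ceiling`, ✓`SwapRing.swap_twistTrace_floor_rpow`: `⟨S⟩_β ≍ β^{−1/2}/log β` at fixed `L`, modulo the sector volumes).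
HONEST LABEL: an assembly/interface layer; the per-sector volume ceilings are NOT proved here (in progress across the cell); fixed-`L` statements with
`exp(O(L⁴ log L))` constants, nothing uniform in `L`; ⟨24197⟩, ⟨24194⟩, ⟨24497⟩, ⟨24196⟩ stay OPEN; no crux, rung or summit is proved; the Yang–Mills mass gap
is NOT proved; no summit is proved by a line.  THEOREMS ONLY (0 `def`, 0 `sorry`), standard axioms.  Width seat ym-line-sfw-p2-w3 g61 (cell ym-idea-1, free
hands), `--supports stmt-QuantumFields-24197`.  References: [cite: tHooft1979]; [cite: Luscher1983, §2]; [cite: Vanbaal2001]; [cite: MontvayMunster1994, (3.145)]; [folklore].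
-/

set_option autoImplicit false

noncomputable section

open MeasureTheory Set
open scoped BigOperators ENNReal Nat
open Literature.MathematicalPhysics.QuantumFieldTheory hiding SU2
open Literature.MathematicalPhysics.QuantumLattice

namespace Summit.QuantumFields.YangMills.Theorems.SwapVirialDeficit.SwapRing

open Summit.QuantumFields.YangMills.Theorems.FemtoTransferGap
open Summit.QuantumFields.YangMills.Theorems.FemtoTransferGap.TT
open Summit.QuantumFields.YangMills.Theorems.VirialFluxGap.RingDeficit
open Summit.QuantumFields.YangMills.Theorems.TwistEaterVolume.Tauber
open Summit.QuantumFields.YangMills.Theorems.SwapTwistDeficit.TwistRatioFloor (twistRatio_floor_of_exists)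

/-! ## §1 The log-free abstract Laplace ceiling -/

section Laplace

variable {Ω : Type*} [MeasurableSpace Ω] {μ : Measure Ω} [IsProbabilityMeasure μ]

/-- **Log-free Laplace ceiling from a power-law volume ceiling**: if `μ{F ≤ s} ≤ C·s^N` for `0 < s ≤ u₀` (probability measure, `F ≥ 0` measurable),
then `∫e^{−βF}dμ ≤ (C + u₀^{−N})·N!/β^N` for every `β > 0` — layer cake, and `1 ≤ (s/u₀)^N` beyond `u₀`. [folklore] -/
theorem integral_exp_neg_mul_le_of_pow_volume (F : Ω → ℝ) (hF : Measurable F) (hF0 : ∀ ω, 0 ≤ F ω) {C u₀ : ℝ} (hC : 0 ≤ C)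
    (hu₀ : 0 < u₀) (N : ℕ) (hvol : ∀ s : ℝ, 0 < s → s ≤ u₀ → μ.real {ω | F ω ≤ s} ≤ C * s ^ N) {β : ℝ} (hβ : 0 < β) :
    ∫ ω, Real.exp (-(β * F ω)) ∂μ ≤ (C + (u₀ ^ N)⁻¹) * N ! / β ^ N := by
  rw [integral_exp_neg_mul_eq_integral_sublevel F hF hF0 hβ]
  have hK : 0 ≤ C + (u₀ ^ N)⁻¹ := by positivity
  -- pointwise domination of the layer-cake integrand
  have hpt : ∀ s ∈ Ioi (0 : ℝ), β * Real.exp (-(β * s)) * μ.real {ω | F ω ≤ s} ≤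
      (C + (u₀ ^ N)⁻¹) * β * (s ^ N * Real.exp (-(β * s))) := by
    intro s hs
    have hs0 : 0 < s := hs
    have hvol' : μ.real {ω | F ω ≤ s} ≤ (C + (u₀ ^ N)⁻¹) * s ^ N := by
      rcases le_or_gt s u₀ with h | h
      · calc μ.real {ω | F ω ≤ s} ≤ C * s ^ N := hvol s hs0 h
          _ ≤ (C + (u₀ ^ N)⁻¹) * s ^ N := by
              have : 0 ≤ (u₀ ^ N)⁻¹ * s ^ N := by positivity
              nlinarith
      · have h1 : (1 : ℝ) ≤ (s / u₀) ^ N := one_le_pow₀ (by rw [le_div_iff₀ hu₀]; linarith)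
        rw [div_pow, div_eq_mul_inv, mul_comm] at h1
        calc μ.real {ω | F ω ≤ s} ≤ 1 := measureReal_le_one
          _ ≤ (u₀ ^ N)⁻¹ * s ^ N := h1
          _ ≤ (C + (u₀ ^ N)⁻¹) * s ^ N := by nlinarith [pow_nonneg hs0.le N]
    have hw : 0 ≤ β * Real.exp (-(β * s)) := by positivity
    calc β * Real.exp (-(β * s)) * μ.real {ω | F ω ≤ s} ≤ β * Real.exp (-(β * s)) * ((C + (u₀ ^ N)⁻¹) * s ^ N) :=
        mul_le_mul_of_nonneg_left hvol' hw
      _ = (C + (u₀ ^ N)⁻¹) * β * (s ^ N * Real.exp (-(β * s))) := by ring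
  have hint1 := integrableOn_mul_exp_neg_mul_mul_sublevel (μ := μ) F hβ
  have hint2 : IntegrableOn (fun s : ℝ => (C + (u₀ ^ N)⁻¹) * β * (s ^ N * Real.exp (-(β * s)))) (Ioi 0) :=
    (integrableOn_pow_mul_exp_neg_mul_Ioi N hβ).const_mul _
  calc ∫ s in Ioi (0 : ℝ), β * Real.exp (-(β * s)) * μ.real {ω | F ω ≤ s}
      ≤ ∫ s in Ioi (0 : ℝ), (C + (u₀ ^ N)⁻¹) * β * (s ^ N * Real.exp (-(β * s))) :=
        setIntegral_mono_on hint1 hint2 measurableSet_Ioi hpt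
    _ = (C + (u₀ ^ N)⁻¹) * β * (N ! / β ^ (N + 1)) := by
        rw [integral_const_mul, integral_pow_mul_exp_neg_mul_Ioi N hβ]
    _ = (C + (u₀ ^ N)⁻¹) * N ! / β ^ N := by
        field_simp
        ring

end Laplace

variable {L : ℕ} [NeZero L]

/-! ## §2 The swap-twisted trace from per-sector volume ceilings -/

/-- ★★ **`Z^S ≤ C_L·e^{12βL⁴}/β^{9L⁴−1}` from per-sector power-law volume ceilings.**  If every seam sector `z` of the σ-glued ring satisfies
`μ_L{F^S_z ≤ u} ≤ C_z·u^{9L⁴−1}` for `0 < u ≤ u₀(z)`, then `TT.twistTrace L β (2L) ≤ C·e^{12βL⁴}·(β^{9L⁴−1})⁻¹` for all `β > 0`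
(`Z^S = (1/8)Σ_z e^{12βL⁴}∫e^{−βF^S_z}dμ_L`, ✓`twistTrace_eq_sum_exp_mul_integral_deficit`, and §1 per sector). [cite: tHooft1979] [cite: MontvayMunster1994, (3.145)] -/
theorem swap_twistTrace_ceiling_of_sectorVolumes
    (hvol : ∀ z : Fin 3 → Bool, ∃ C : ℝ, 0 ≤ C ∧ ∃ u₀ : ℝ, 0 < u₀ ∧ ∀ u : ℝ, 0 < u → u ≤ u₀ →
      (ringMeasure L).real {P | swapRingDeficit L z P ≤ u} ≤ C * u ^ (9 * L ^ 4 - 1)) :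
    ∃ C : ℝ, 0 < C ∧ ∀ β : ℝ, 0 < β →
      TT.twistTrace L β (2 * L) ≤ C * Real.exp (12 * β * (L : ℝ) ^ 4) * (β ^ (9 * L ^ 4 - 1))⁻¹ := by
  haveI := isProbabilityMeasure_ringMeasure (L := L)
  -- per-sector Laplace ceilings
  have hlap : ∀ z : Fin 3 → Bool, ∃ C' : ℝ, 0 < C' ∧ ∀ β : ℝ, 0 < β →
      ∫ P, Real.exp (-(β * swapRingDeficit L z P)) ∂(ringMeasure L) ≤ C' / β ^ (9 * L ^ 4 - 1) := by
    intro z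
    obtain ⟨C, hC, u₀, hu₀, hv⟩ := hvol z
    refine ⟨(C + (u₀ ^ (9 * L ^ 4 - 1))⁻¹) * (9 * L ^ 4 - 1) !, by positivity, fun β hβ => ?_⟩
    exact integral_exp_neg_mul_le_of_pow_volume (μ := ringMeasure L) (swapRingDeficit L z) (measurable_swapRingDeficit _)
      (swapRingDeficit_nonneg (L := L) z) hC hu₀ _ hv hβ
  choose Cz hCz hlapz using hlap
  have hsum : 0 < ∑ z : Fin 3 → Bool, Cz z := Finset.sum_pos (fun z _ => hCz z) Finset.univ_nonempty
  refine ⟨(1 / 8 : ℝ) * ∑ z : Fin 3 → Bool, Cz z, by positivity, fun β hβ => ?_⟩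
  rw [twistTrace_eq_sum_exp_mul_integral_deficit]
  have hterm : ∀ z : Fin 3 → Bool, Real.exp (12 * β * (L : ℝ) ^ 4) * ∫ P, Real.exp (-(β * swapRingDeficit L z P)) ∂(ringMeasure L) ≤
      Cz z * (Real.exp (12 * β * (L : ℝ) ^ 4) * (β ^ (9 * L ^ 4 - 1))⁻¹) := by
    intro z
    have h := hlapz z β hβ
    rw [div_eq_mul_inv] at h
    calc Real.exp (12 * β * (L : ℝ) ^ 4) * ∫ P, Real.exp (-(β * swapRingDeficit L z P)) ∂(ringMeasure L)
        ≤ Real.exp (12 * β * (L : ℝ) ^ 4) * (Cz z * (β ^ (9 * L ^ 4 - 1))⁻¹) := mul_le_mul_of_nonneg_left h (Real.exp_pos _).le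
      _ = Cz z * (Real.exp (12 * β * (L : ℝ) ^ 4) * (β ^ (9 * L ^ 4 - 1))⁻¹) := by ring
  calc (1 / 8 : ℝ) * ∑ z : Fin 3 → Bool, Real.exp (12 * β * (L : ℝ) ^ 4) * ∫ P, Real.exp (-(β * swapRingDeficit L z P)) ∂(ringMeasure L)
      ≤ (1 / 8 : ℝ) * ∑ z : Fin 3 → Bool, Cz z * (Real.exp (12 * β * (L : ℝ) ^ 4) * (β ^ (9 * L ^ 4 - 1))⁻¹) :=
        mul_le_mul_of_nonneg_left (Finset.sum_le_sum fun z _ => hterm z) (by norm_num)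
    _ = (1 / 8 : ℝ) * (∑ z : Fin 3 → Bool, Cz z) * Real.exp (12 * β * (L : ℝ) ^ 4) * (β ^ (9 * L ^ 4 - 1))⁻¹ := by
        rw [← Finset.sum_mul]; ring

/-! ## §3 The twist ratio: ceiling and two-sided law from per-sector volume ceilings -/

/-- **The twist ratio decays at least as fast as `β^{−1/2}/log β` (parametric bookkeeping)**: from `Z ≥ c·e^{12βL⁴}β^{−(9L⁴−3/2)}·log β` (`β ≥ β₁`) and
`Z^S ≤ C·e^{12βL⁴}·(β^{9L⁴−1})⁻¹` (`β > 0`): `Z^S/Z ≤ (C/c)·β^{−1/2}/log β` for `β ≥ max β₁ 2`. [folklore] -/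
theorem twistRatio_ceiling_of_bounds (hL : 1 ≤ L) {c C β₁ : ℝ} (hc : 0 < c) (hC : 0 < C)
    (hfloor : ∀ β : ℝ, β₁ ≤ β →
      c * Real.exp (12 * β * (L : ℝ) ^ 4) * β ^ (-(9 * (L : ℝ) ^ 4 - 3 / 2)) * Real.log β ≤ TT.physTrace L β (2 * L))
    (hceil : ∀ β : ℝ, 0 < β → TT.twistTrace L β (2 * L) ≤ C * Real.exp (12 * β * (L : ℝ) ^ 4) * (β ^ (9 * L ^ 4 - 1))⁻¹) :
    ∀ β : ℝ, max β₁ 2 ≤ β →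
      TT.twistTrace L β (2 * L) / TT.physTrace L β (2 * L) ≤ C / c * (β ^ (-(1 / 2 : ℝ)) / Real.log β) := by
  intro β hβ
  have hβ₁ : β₁ ≤ β := (le_max_left _ _).trans hβ
  have hβ2 : 2 ≤ β := (le_max_right _ _).trans hβ
  have hβ0 : 0 < β := by linarith
  have hlog : 0 < Real.log β := Real.log_pos (by linarith)
  have hE : 0 < Real.exp (12 * β * (L : ℝ) ^ 4) := Real.exp_pos _
  have hpa : 0 < β ^ (-(9 * (L : ℝ) ^ 4 - 3 / 2)) := Real.rpow_pos_of_pos hβ0 _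
  have hph : 0 < β ^ (-(1 / 2 : ℝ)) := Real.rpow_pos_of_pos hβ0 _
  have hZ : 0 < TT.physTrace L β (2 * L) := TT.physTrace_two_mul_pos hL (by linarith)
  -- the exponent bookkeeping `(β^{9L⁴−1})⁻¹ = β^{−1/2} · β^{−(9L⁴−3/2)}`
  have hL4 : 1 ≤ 9 * L ^ 4 := by have := Nat.one_le_pow 4 L hL; omega
  have hN : (β ^ (9 * L ^ 4 - 1))⁻¹ = β ^ (-(1 / 2 : ℝ)) * β ^ (-(9 * (L : ℝ) ^ 4 - 3 / 2)) := by
    rw [← Real.rpow_natCast, ← Real.rpow_neg hβ0.le, ← Real.rpow_add hβ0]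
    congr 1
    rw [Nat.cast_sub hL4]; push_cast; ring
  have hU := hceil β hβ0
  rw [hN] at hU
  have hV := hfloor β hβ₁
  have hV0 : 0 < c * Real.exp (12 * β * (L : ℝ) ^ 4) * β ^ (-(9 * (L : ℝ) ^ 4 - 3 / 2)) * Real.log β := by positivity
  have hU0 : 0 ≤ C * Real.exp (12 * β * (L : ℝ) ^ 4) * (β ^ (-(1 / 2 : ℝ)) * β ^ (-(9 * (L : ℝ) ^ 4 - 3 / 2))) := by positivity
  have hratio : C / c * (β ^ (-(1 / 2 : ℝ)) / Real.log β) =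
      (C * Real.exp (12 * β * (L : ℝ) ^ 4) * (β ^ (-(1 / 2 : ℝ)) * β ^ (-(9 * (L : ℝ) ^ 4 - 3 / 2)))) /
        (c * Real.exp (12 * β * (L : ℝ) ^ 4) * β ^ (-(9 * (L : ℝ) ^ 4 - 3 / 2)) * Real.log β) := by
    field_simp
  rw [hratio]
  exact div_le_div₀ hU0 hU hV0 hV

/-- ★★ **`⟨S⟩_β ≤ κ_L·β^{−1/2}/log β` from per-sector volume ceilings** (with the periodic FLOOR ✓`PeriodicRingFloor.log_physTrace_floor`). [cite: tHooft1979]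
[cite: Luscher1983, §2] [cite: Vanbaal2001] -/
theorem twistRatio_ceiling_of_sectorVolumes
    (hvol : ∀ z : Fin 3 → Bool, ∃ C : ℝ, 0 ≤ C ∧ ∃ u₀ : ℝ, 0 < u₀ ∧ ∀ u : ℝ, 0 < u → u ≤ u₀ →
      (ringMeasure L).real {P | swapRingDeficit L z P ≤ u} ≤ C * u ^ (9 * L ^ 4 - 1)) :
    ∃ κ : ℝ, 0 < κ ∧ ∃ β₀ : ℝ, ∀ β : ℝ, β₀ ≤ β →
      TT.twistTrace L β (2 * L) / TT.physTrace L β (2 * L) ≤ κ * (β ^ (-(1 / 2 : ℝ)) / Real.log β) := by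
  obtain ⟨c, hc, β₁, hfloor⟩ := SwapTwistDeficit.PeriodicRingFloor.log_physTrace_floor L
  obtain ⟨C, hC, hceil⟩ := swap_twistTrace_ceiling_of_sectorVolumes (L := L) hvol
  exact ⟨C / c, div_pos hC hc, max β₁ 2, twistRatio_ceiling_of_bounds NeZero.one_le hc hC hfloor hceil⟩

/-- ★★★ **`⟨S⟩_β ≍ β^{−1/2}/log β` at fixed `L`, from per-sector volume ceilings**: the two-sided fixed-`L` prediction row of seat w2 g54's census
SWAP-STRATA — lower half unconditional (✓`twistRatio_floor_of_exists` with ✓`PeriodicRingCeiling.log_physTrace_ceiling` and ✓`SwapRing.swap_twistTrace_floor_rpow`),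
upper half from the sector volumes. [cite: tHooft1979] [cite: Luscher1983, §2] [cite: Vanbaal2001] -/
theorem twistRatio_two_sided_of_sectorVolumes
    (hvol : ∀ z : Fin 3 → Bool, ∃ C : ℝ, 0 ≤ C ∧ ∃ u₀ : ℝ, 0 < u₀ ∧ ∀ u : ℝ, 0 < u → u ≤ u₀ →
      (ringMeasure L).real {P | swapRingDeficit L z P ≤ u} ≤ C * u ^ (9 * L ^ 4 - 1)) :
    ∃ κ₁ : ℝ, 0 < κ₁ ∧ ∃ κ₂ : ℝ, 0 < κ₂ ∧ ∃ β₀ : ℝ, ∀ β : ℝ, β₀ ≤ β →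
      κ₁ * (β ^ (-(1 / 2 : ℝ)) / Real.log β) ≤ TT.twistTrace L β (2 * L) / TT.physTrace L β (2 * L) ∧
        TT.twistTrace L β (2 * L) / TT.physTrace L β (2 * L) ≤ κ₂ * (β ^ (-(1 / 2 : ℝ)) / Real.log β) := by
  obtain ⟨κ₁, hκ₁, β₁, hlow⟩ := twistRatio_floor_of_exists (L := L) NeZero.one_le
    (ToronValleyVolume.PeriodicRingCeiling.log_physTrace_ceiling L) (swap_twistTrace_floor_rpow L)
  obtain ⟨κ₂, hκ₂, β₂, hup⟩ := twistRatio_ceiling_of_sectorVolumes (L := L) hvol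
  exact ⟨κ₁, hκ₁, κ₂, hκ₂, max β₁ β₂, fun β hβ => ⟨hlow β ((le_max_left _ _).trans hβ), hup β ((le_max_right _ _).trans hβ)⟩⟩

end Summit.QuantumFields.YangMills.Theorems.SwapVirialDeficit.SwapRing

end
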